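import Summits.KontsevichZagierPeriods.KontsevichZagierPeriods.Theorems.RootDecompQuadraticDescentPair18ReductionP1

/-! # `RootDecompQuadraticDescentPair18ReductionP2` — part 2/7 of the mechanical ≤400-line split of `Pair18Reduction_v5_landing.lean` (sha256 0a10c70876ba8bf2…)
Source: decomp-kz lens-6 g8 `Pair18Reduction.lean` v5 (HOME/decomp-kz-lens-6/g8/, sha256 9036e907…; critic g3 CLEARED 12:08:58Z/13:14:52Z): census pair #18 reduced to strips — `pair18_iff_strips : KZ.of A18.rep − 2 • KZ.of B18.rep ∈ KZ.relations ↔ [U1] − [U2r] + [SL] − 2•[K12c] + 2•[Kh] ∈ KZ.relations` (namespace …RootDecompQuadraticDescent.Pair18); `#print axioms` pins removed for landing.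
Split by census-1 g9 `gen/splitlean.py`: scopes re-opened with their `open`/`variable`/`set_option` context; mathematics and declaration order unchanged. -/

noncomputable section
open MeasureTheory Set MvPolynomial
namespace Summit.KontsevichZagierPeriods.RootDecompQuadraticDescent.Pair18
open Literature.NumberTheory.Transcendental
open Literature.NumberTheory.Transcendental.KZ
open Literature.ModelTheory.ExponentialFields (IsSemialgebraic continuous_aeval_real)
open Summit.KontsevichZagierPeriods.RootDecompQuadraticDescent.DarkPairs (rel_reflect_rep rel_double
  update_one_apply_zero one_div_eq_mul_one_div)

/-- **(base map)** a base substitution `t' = κ(t)`, `κ = p/q ∈ ℚ(t)` injective on `[0,1]` with image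
`[lo, hi]`, lifted to bands with lower edge `1` (rule 2, Literature `KZ.of_sub_of_mem_relations_covLift`);
the Jacobian is `|κ'(t)|`. -/
theorem rel_base (κ κd : ℝ → ℝ) (pκ qκ : MvPolynomial (Fin 1) ℚ)
    (hq : ∀ y ∈ ivl 0 1, aeval y qκ ≠ 0) (hκq : ∀ y ∈ ivl 0 1, aeval y pκ / aeval y qκ = κ (y 0))
    (hκd : ∀ t ∈ Icc (0 : ℝ) 1, HasDerivAt κ (κd t) t) (hinj : InjOn κ (Icc (0 : ℝ) 1)) (lo hi : ℚ)
    (himg : κ '' Icc (0 : ℝ) 1 = Icc (lo : ℝ) hi) (v v' : (Fin 1 → ℝ) → ℝ)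
    (hvv' : ∀ y ∈ ivl 0 1, v y = v' (fun _ => κ (y 0))) (R R' : KZ.IntegralRep 2)
    (hR : R.domain = KZlog.band (ivl 0 1) (fun _ => 1) v)
    (hR' : R'.domain = KZlog.band (ivl lo hi) (fun _ => 1) v')
    (hint : ∀ z ∈ R.domain, R.integrand z =
      R'.integrand (Fin.snoc (fun _ : Fin 1 => κ (z 0)) (z 1)) * |κd (z 0)|) :
    KZ.of R - KZ.of R' ∈ KZ.relations := by
  have hσ := isSemialgebraic_ivl 0 1
  let Φ : (Fin 1 → ℝ) → (Fin 1 → ℝ) := fun y _ => κ (y 0)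
  let Φ' : (Fin 1 → ℝ) → (Fin 1 → ℝ) →L[ℝ] (Fin 1 → ℝ) := fun y =>
    κd (y 0) • ContinuousLinearMap.id ℝ (Fin 1 → ℝ)
  have hdet : ∀ y, (Φ' y).det = κd (y 0) := fun y => by
    simp only [Φ', ContinuousLinearMap.det, ContinuousLinearMap.toLinearMap_smul,
      ContinuousLinearMap.coe_id, LinearMap.det_smul, LinearMap.det_id, Module.finrank_fin_fun,
      pow_one, mul_one]
  have himage : Φ '' ivl 0 1 = ivl lo hi := by
    ext w
    constructor
    · rintro ⟨y, hy, rfl⟩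
      have : κ (y 0) ∈ Icc (lo : ℝ) hi := by rw [← himg]; exact mem_image_of_mem κ (I01 hy)
      exact this
    · intro hw
      obtain ⟨t, ht, htw⟩ : w 0 ∈ κ '' Icc (0 : ℝ) 1 := by rw [himg]; exact hw
      refine ⟨fun _ => t, ?_, ?_⟩
      · show ((0 : ℚ) : ℝ) ≤ t ∧ t ≤ ((1 : ℚ) : ℝ); push_cast; exact ht
      · funext i
        rw [Fin.fin_one_eq_zero i]
        exact htw
  refine KZ.of_sub_of_mem_relations_covLift (σ := ivl 0 1) (Φ := Φ) (Φ' := Φ')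
    (v := v) (v' := v') ?_ ?_ ?_ (fun y hy => hvv' y hy) R R' hR (by rw [himage]; exact hR')
    fun z hz => ?_
  · exact (isSemialgebraicMapOn_iff_forall_holds hσ).mpr fun _ =>
      (isSemialgebraicFunOn_aeval_div_aeval hσ pκ qκ hq).congr fun y hy => by
        show aeval y pκ / aeval y qκ = κ (y 0)
        exact hκq y hy
  · intro y hy
    have h1 : HasFDerivAt (fun y : Fin 1 → ℝ => κ (y 0))
        (κd (y 0) • ContinuousLinearMap.proj (R := ℝ) (φ := fun _ : Fin 1 => ℝ) 0) y :=
      (hκd _ (I01 hy)).comp_hasFDerivAt y (hasFDerivAt_apply 0 y)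
    have h2 : HasFDerivAt Φ (ContinuousLinearMap.pi fun _ : Fin 1 =>
        κd (y 0) • ContinuousLinearMap.proj (R := ℝ) (φ := fun _ : Fin 1 => ℝ) 0) y :=
      hasFDerivAt_pi.2 fun _ => h1
    have h3 : (ContinuousLinearMap.pi fun _ : Fin 1 =>
        κd (y 0) • ContinuousLinearMap.proj (R := ℝ) (φ := fun _ : Fin 1 => ℝ) 0) = Φ' y := by
      ext w i
      rw [Fin.fin_one_eq_zero i]
      simp [Φ']
    exact (h3 ▸ h2).hasFDerivWithinAt
  · intro y₁ hy₁ y₂ hy₂ h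
    have h0 : κ (y₁ 0) = κ (y₂ 0) := congrFun h 0
    funext i
    rw [Fin.fin_one_eq_zero i]
    exact hinj (I01 hy₁) (I01 hy₂) h0
  · rw [hdet, hint z hz]
    rfl

/-- The line `{t = q}` in `ℝ²` is null. -/
private theorem volume_vline (q : ℝ) : volume {z : Fin 2 → ℝ | z 0 = q} = 0 :=
  measure_mono_null (fun _ hz => hz)
    (KZ.volume_setOf_init_mem_eq_zero (n := 1) (KZ.volume_setOf_last_eq_zero (n := 0) q))

/-- The part of a lower-edge-`1` band over the sub-interval `[lo, hi] ⊆ [0, 1]` of the base. -/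
def vband (lo hi : ℚ) (U : Edge) : Set (Fin 2 → ℝ) :=
  KZlog.band (ivl lo hi) (fun _ => (1 : ℝ)) (fun y => U.onePlus.f (y 0))

/-- Auxiliary step `mem_vband`: mem vband. [bookkeeping] -/
theorem mem_vband {lo hi : ℚ} {U : Edge} {z : Fin 2 → ℝ} :
    z ∈ vband lo hi U ↔ ((lo : ℝ) ≤ z 0 ∧ z 0 ≤ hi) ∧ 1 ≤ z 1 ∧ z 1 ≤ 1 + U.f (z 0) := by
  show (Fin.init z ∈ ivl lo hi ∧ (1 : ℝ) ≤ z (Fin.last 1) ∧ z (Fin.last 1) ≤ 1 + U.f (Fin.init z 0)) ↔ _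
  rw [mem_ivl]
  rfl

/-- Auxiliary step `ivl_subset`: ivl subset. [bookkeeping] -/
private theorem ivl_subset {lo hi : ℚ} (hlo : 0 ≤ lo) (hhi : hi ≤ 1) : ivl lo hi ⊆ ivl 0 1 := fun y hy => by
  rw [mem_ivl] at hy ⊢
  have h1 : ((0 : ℚ) : ℝ) ≤ lo := by exact_mod_cast hlo
  have h2 : ((hi : ℚ) : ℝ) ≤ ((1 : ℚ) : ℝ) := by exact_mod_cast hhi
  exact ⟨h1.trans hy.1, hy.2.trans h2⟩

/-- Auxiliary step `isSemialgebraic_vband`: is Semialgebraic vband. [bookkeeping] -/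
theorem isSemialgebraic_vband (lo hi : ℚ) (hlo : 0 ≤ lo) (hhi : hi ≤ 1) (U : Edge) :
    IsSemialgebraic ℚ (vband lo hi U) :=
  KZlog.isSemialgebraic_band
    ((isSemialgebraicFunOn_ratCast (isSemialgebraic_ivl lo hi) 1).congr fun y _ => by simp)
    (U.onePlus.sa.mono (ivl_subset hlo hhi) (isSemialgebraic_ivl lo hi))

/-- Auxiliary step `vband_subset`: vband subset. [bookkeeping] -/
theorem vband_subset (lo hi : ℚ) (hlo : 0 ≤ lo) (hhi : hi ≤ 1) (U : Edge) :
    vband lo hi U ⊆ sbDom oneE U.onePlus := fun z hz => by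
  rw [mem_vband] at hz
  rw [mem_sbDom]
  have h1 : ((0 : ℚ) : ℝ) ≤ lo := by exact_mod_cast hlo
  have h2 : ((hi : ℚ) : ℝ) ≤ ((1 : ℚ) : ℝ) := by exact_mod_cast hhi
  push_cast at h1 h2
  exact ⟨⟨h1.trans hz.1.1, hz.1.2.trans h2⟩, by simpa using hz.2.1, by simpa using hz.2.2⟩

/-! ## §4 Generic pieces: polynomial-quotient bands, vertical pieces, open-base null moves, band cuts -/

/-- Auxiliary step `abs_div_le_of_le` (§4): abs div le of le. [bookkeeping] -/
theorem abs_div_le_of_le {c D a : ℝ} (ha : 0 < a) (hD : a ≤ D) : |c / D| ≤ |c| / a := by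
  rw [abs_div, abs_of_pos (ha.trans_le hD)]
  exact div_le_div_of_nonneg_left (abs_nonneg c) ha hD

/-- A band representation with integrand `P/Q`, `Q ≥ δ > 0` and `|P| ≤ K` on the band. -/
def BRq (L U : Edge) (P Q : MvPolynomial (Fin 2) ℚ) (δ K : ℝ) (hδ : 0 < δ)
    (hQ : ∀ z ∈ sbDom L U, δ ≤ aeval z Q) (hP : ∀ z ∈ sbDom L U, |aeval z P| ≤ K) :
    KZ.IntegralRep 2 :=
  BR L U (fun z => aeval z P / aeval z Q)
    (isSemialgebraicFunOn_aeval_div_aeval (isSemialgebraic_sbDom L U) P Q fun z hz =>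
      (hδ.trans_le (hQ z hz)).ne')
    ((continuous_aeval_real P).continuousOn.div (continuous_aeval_real Q).continuousOn fun z hz =>
      (hδ.trans_le (hQ z hz)).ne')
    (K / δ) fun z hz => (abs_div_le_of_le hδ (hQ z hz)).trans
      (div_le_div_of_nonneg_right (hP z hz) hδ.le)

/-- Auxiliary step `BRq_domain` (§4): BRq domain. [bookkeeping] -/
@[simp] theorem BRq_domain (L U : Edge) (P Q δ K hδ hQ hP) :
    (BRq L U P Q δ K hδ hQ hP).domain = sbDom L U := rfl
/-- Auxiliary step `BRq_integrand` (§4): BRq integrand. [bookkeeping] -/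
@[simp] theorem BRq_integrand (L U : Edge) (P Q δ K hδ hQ hP) (z : Fin 2 → ℝ) :
    (BRq L U P Q δ K hδ hQ hP).integrand z = aeval z P / aeval z Q := rfl

/-- The part of a representation on the shifted band `sbDom oneE U.onePlus` over the base sub-interval
`[lo, hi]`. -/
def VB (R : KZ.IntegralRep 2) (U : Edge) (hR : R.domain = sbDom oneE U.onePlus) (lo hi : ℚ)
    (hlo : 0 ≤ lo) (hhi : hi ≤ 1) : KZ.IntegralRep 2 :=
  R.restrict (vband lo hi U) (isSemialgebraic_vband lo hi hlo hhi U)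
    (by rw [hR]; exact vband_subset lo hi hlo hhi U)

/-- Auxiliary step `VB_domain` (§4): VB domain. [bookkeeping] -/
@[simp] theorem VB_domain (R : KZ.IntegralRep 2) (U : Edge) (hR lo hi hlo hhi) :
    (VB R U hR lo hi hlo hhi).domain = vband lo hi U := rfl
/-- Auxiliary step `VB_integrand` (§4): VB integrand. [bookkeeping] -/
@[simp] theorem VB_integrand (R : KZ.IntegralRep 2) (U : Edge) (hR lo hi hlo hhi) :
    (VB R U hR lo hi hlo hhi).integrand = R.integrand := rfl

/-- **(base cut)** additivity along the vertical line `t = q` (rule 1a). -/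
theorem vcut (R : KZ.IntegralRep 2) (U : Edge) (hR : R.domain = sbDom oneE U.onePlus) (q : ℚ)
    (hq0 : 0 ≤ q) (hq1 : q ≤ 1) :
    KZ.of R - KZ.of (VB R U hR 0 q le_rfl hq1) - KZ.of (VB R U hR q 1 hq0 le_rfl) ∈ KZ.relations := by
  refine KZ.domainAddRel_subset_relations ⟨2, R, VB R U hR 0 q le_rfl hq1, VB R U hR q 1 hq0 le_rfl,
    ?_, ?_, fun z _ => rfl, fun z _ => rfl, rfl⟩
  · rw [hR]
    ext z
    simp only [VB_domain, mem_union, mem_sbDom, mem_vband, oneE_f, Edge.onePlus_f, Rat.cast_zero,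
      Rat.cast_one]
    constructor
    · rintro ⟨⟨h0, h0'⟩, h1, h2⟩
      rcases le_total (z 0) (q : ℝ) with h | h
      · exact Or.inl ⟨⟨h0, h⟩, h1, h2⟩
      · exact Or.inr ⟨⟨h, h0'⟩, h1, h2⟩
    · have hq0' : (0 : ℝ) ≤ q := by exact_mod_cast hq0
      have hq1' : (q : ℝ) ≤ 1 := by exact_mod_cast hq1
      rintro (⟨⟨h0, h0'⟩, h1, h2⟩ | ⟨⟨h0, h0'⟩, h1, h2⟩)
      · exact ⟨⟨h0, h0'.trans hq1'⟩, h1, h2⟩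
      · exact ⟨⟨hq0'.trans h0, h0'⟩, h1, h2⟩
  · refine measure_mono_null (fun z hz => ?_) (volume_vline (q : ℝ))
    have h1 : z ∈ vband 0 q U := hz.1
    have h2 : z ∈ vband q 1 U := hz.2
    rw [mem_vband] at h1 h2
    exact le_antisymm h1.1.2 h2.1.1

/-- The lower / upper pieces of a band representation cut along a middle edge (rule 1a). -/
def loP (R : KZ.IntegralRep 2) (L M U : Edge) (hR : R.domain = sbDom L U)
    (hMU : ∀ t ∈ Icc (0 : ℝ) 1, M.f t ≤ U.f t) : KZ.IntegralRep 2 :=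
  R.restrict (sbDom L M) (isSemialgebraic_sbDom L M) (by
    rw [hR]; intro z hz
    obtain ⟨h0, h1, h2⟩ := mem_sbDom.1 hz
    exact mem_sbDom.2 ⟨h0, h1, h2.trans (hMU _ h0)⟩)

/-- Auxiliary definition `hiP` (§4): hi P. [bookkeeping] -/
def hiP (R : KZ.IntegralRep 2) (L M U : Edge) (hR : R.domain = sbDom L U)
    (hLM : ∀ t ∈ Icc (0 : ℝ) 1, L.f t ≤ M.f t) : KZ.IntegralRep 2 :=
  R.restrict (sbDom M U) (isSemialgebraic_sbDom M U) (by
    rw [hR]; intro z hz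
    obtain ⟨h0, h1, h2⟩ := mem_sbDom.1 hz
    exact mem_sbDom.2 ⟨h0, (hLM _ h0).trans h1, h2⟩)

/-- Auxiliary step `loP_domain` (§4): lo P domain. [bookkeeping] -/
@[simp] theorem loP_domain (R : KZ.IntegralRep 2) (L M U : Edge) (hR hMU) :
    (loP R L M U hR hMU).domain = sbDom L M := rfl
/-- Auxiliary step `loP_integrand` (§4): lo P integrand. [bookkeeping] -/
@[simp] theorem loP_integrand (R : KZ.IntegralRep 2) (L M U : Edge) (hR hMU) :
    (loP R L M U hR hMU).integrand = R.integrand := rfl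
/-- Auxiliary step `hiP_domain` (§4): hi P domain. [bookkeeping] -/
@[simp] theorem hiP_domain (R : KZ.IntegralRep 2) (L M U : Edge) (hR hLM) :
    (hiP R L M U hR hLM).domain = sbDom M U := rfl
/-- Auxiliary step `hiP_integrand` (§4): hi P integrand. [bookkeeping] -/
@[simp] theorem hiP_integrand (R : KZ.IntegralRep 2) (L M U : Edge) (hR hLM) :
    (hiP R L M U hR hLM).integrand = R.integrand := rfl

/-- **(band cut)** `[L ≤ σ ≤ U] = [L ≤ σ ≤ M] + [M ≤ σ ≤ U]` (rule 1a). -/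
theorem br_cut (R : KZ.IntegralRep 2) (L M U : Edge) (hR : R.domain = sbDom L U)
    (hLM : ∀ t ∈ Icc (0 : ℝ) 1, L.f t ≤ M.f t) (hMU : ∀ t ∈ Icc (0 : ℝ) 1, M.f t ≤ U.f t) :
    KZ.of R - KZ.of (loP R L M U hR hMU) - KZ.of (hiP R L M U hR hLM) ∈ KZ.relations := by
  refine KZ.domainAddRel_subset_relations ⟨2, R, loP R L M U hR hMU, hiP R L M U hR hLM, ?_, ?_,
    fun z _ => rfl, fun z _ => rfl, rfl⟩
  · rw [hR]
    ext z
    simp only [loP_domain, hiP_domain, mem_union, mem_sbDom]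
    constructor
    · rintro ⟨h0, h1, h2⟩
      rcases le_total (z 1) (M.f (z 0)) with h | h
      · exact Or.inl ⟨h0, h1, h⟩
      · exact Or.inr ⟨h0, h, h2⟩
    · rintro (⟨h0, h1, h2⟩ | ⟨h0, h1, h2⟩)
      · exact ⟨h0, h1, h2.trans (hMU _ h0)⟩
      · exact ⟨h0, (hLM _ h0).trans h1, h2⟩
  · refine measure_mono_null (fun z hz => ?_) (KZ.volume_graph_eq_zero M.sa)
    have h1 : z ∈ sbDom L M := hz.1
    have h2 : z ∈ sbDom M U := hz.2
    refine ⟨h1.1, ?_⟩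
    show z (Fin.last 1) = M.f (Fin.init z 0)
    exact le_antisymm h1.2.2 h2.2.1

/-! ### Open base and the null moves -/

/-- Auxiliary definition `Gopen` (§4): Gopen. [bookkeeping] -/
def Gopen : Set (Fin 1 → ℝ) := {y | 0 < y 0 ∧ y 0 < 1}

/-- Auxiliary step `isOpen_Gopen` (§4): is Open Gopen. [bookkeeping] -/
theorem isOpen_Gopen : IsOpen Gopen :=
  (isOpen_lt continuous_const (continuous_apply 0)).inter (isOpen_lt (continuous_apply 0) continuous_const)

/-- Auxiliary step `Gopen_subset` (§4): Gopen subset. [bookkeeping] -/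
theorem Gopen_subset : Gopen ⊆ ivl 0 1 := fun y hy => by
  rw [mem_ivl]; push_cast; exact ⟨hy.1.le, hy.2.le⟩

/-- Auxiliary step `isSemialgebraic_Gopen` (§4): is Semialgebraic Gopen. [bookkeeping] -/
theorem isSemialgebraic_Gopen : IsSemialgebraic ℚ Gopen := by
  have h1 := Literature.ModelTheory.ExponentialFields.isSemialgebraic_setOf_eval_lt (k := ℚ) (R := ℝ)
    (C 0 : MvPolynomial (Fin 1) ℚ) (X 0)
  have h2 := Literature.ModelTheory.ExponentialFields.isSemialgebraic_setOf_eval_lt (k := ℚ) (R := ℝ)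
    (X 0 : MvPolynomial (Fin 1) ℚ) (C 1)
  simp only [aeval_X, aeval_C, eq_ratCast, Rat.cast_zero, Rat.cast_one] at h1 h2
  exact h1.inter h2

/-- The open-base part `{0 < t < 1, L(t) ≤ σ ≤ U(t)}` of `sbDom L U`. -/
def obDom (L U : Edge) : Set (Fin 2 → ℝ) :=
  KZlog.band Gopen (fun y => L.f (y 0)) (fun y => U.f (y 0))

/-- Auxiliary step `mem_obDom` (§4): mem ob Dom. [bookkeeping] -/
theorem mem_obDom {L U : Edge} {z : Fin 2 → ℝ} :
    z ∈ obDom L U ↔ ((0 : ℝ) < z 0 ∧ z 0 < 1) ∧ L.f (z 0) ≤ z 1 ∧ z 1 ≤ U.f (z 0) := by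
  show (Fin.init z ∈ Gopen ∧ L.f (Fin.init z 0) ≤ z (Fin.last 1) ∧
    z (Fin.last 1) ≤ U.f (Fin.init z 0)) ↔ _
  rfl

/-- Auxiliary step `isSemialgebraic_obDom` (§4): is Semialgebraic ob Dom. [bookkeeping] -/
theorem isSemialgebraic_obDom (L U : Edge) : IsSemialgebraic ℚ (obDom L U) :=
  KZlog.isSemialgebraic_band (L.sa.mono Gopen_subset isSemialgebraic_Gopen)
    (U.sa.mono Gopen_subset isSemialgebraic_Gopen)

/-- Auxiliary step `obDom_subset` (§4): ob Dom subset. [bookkeeping] -/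
theorem obDom_subset (L U : Edge) : obDom L U ⊆ sbDom L U := fun z hz => by
  rw [mem_obDom] at hz
  exact mem_sbDom.2 ⟨⟨hz.1.1.le, hz.1.2.le⟩, hz.2⟩

/-- Auxiliary step `volume_edges` (§4): volume edges. [bookkeeping] -/
private theorem volume_edges : volume ({z : Fin 2 → ℝ | z 0 = 0} ∪ {z | z 0 = 1}) = 0 :=
  measure_union_null (volume_vline 0) (volume_vline 1)

/-- Auxiliary step `volume_sbDom_diff_obDom` (§4): volume sb Dom diff ob Dom. [bookkeeping] -/
theorem volume_sbDom_diff_obDom (L U : Edge) : volume (sbDom L U \ obDom L U) = 0 := by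
  refine measure_mono_null (fun z hz => ?_) volume_edges
  obtain ⟨hz, hz'⟩ := hz
  obtain ⟨⟨h0, h1⟩, h2, h3⟩ := mem_sbDom.1 hz
  rw [mem_obDom] at hz'
  by_contra h
  simp only [mem_union, mem_setOf_eq, not_or] at h
  exact hz' ⟨⟨lt_of_le_of_ne h0 (Ne.symm h.1), lt_of_le_of_ne h1 h.2⟩, h2, h3⟩

/-- The open-base restriction of a band representation. -/
def OB (R : KZ.IntegralRep 2) (L U : Edge) (hR : R.domain = sbDom L U) : KZ.IntegralRep 2 :=
  R.restrict (obDom L U) (isSemialgebraic_obDom L U) (by rw [hR]; exact obDom_subset L U)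

/-- Auxiliary step `OB_domain` (§4): OB domain. [bookkeeping] -/
@[simp] theorem OB_domain (R : KZ.IntegralRep 2) (L U : Edge) (hR) :
    (OB R L U hR).domain = obDom L U := rfl
/-- Auxiliary step `OB_integrand` (§4): OB integrand. [bookkeeping] -/
@[simp] theorem OB_integrand (R : KZ.IntegralRep 2) (L U : Edge) (hR) :
    (OB R L U hR).integrand = R.integrand := rfl

/-- **(null move)** removing the two boundary fibres `t = 0`, `t = 1` (rule 1a with a null piece). -/
theorem rel_open (R : KZ.IntegralRep 2) (L U : Edge) (hR : R.domain = sbDom L U) :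
    KZ.of R - KZ.of (OB R L U hR) ∈ KZ.relations :=
  IntegralRep.of_sub_of_restrict_mem_relations R (isSemialgebraic_obDom L U) _
    (by rw [hR]; exact volume_sbDom_diff_obDom L U)

end Summit.KontsevichZagierPeriods.RootDecompQuadraticDescent.Pair18
end
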